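import Summits.AtomisticToContinuum.Crystallization.Theorems.BraggSlacknessRigidityStrictCertificateDesign
import Summits.AtomisticToContinuum.Crystallization.Theorems.BraggSlacknessRigidityStrictCertificateNecessary
import Summits.AtomisticToContinuum.Crystallization.Theorems.BraggSlacknessRigidityStrictCertificateBragg

/-!
# Crux `StrictCertificate` (stmt-AtomisticToContinuum-13167, route `BraggSlacknessRigidity`):
# the strategist's three-piece DECOMPOSITION — identify · far field on the box · core completion

Support file (crux-strategist `planner-cstrat-stmt-AtomisticToContinuum-13167-s1-0`, 2026-08-17; registered sub-goal
`farField_of_strictCertificate`); nothing here closes the item.  It supplies the kernel-checked ASSEMBLY of a typed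
split of the crux into three pieces living on three different dockets, and the bookkeeping saying what each piece is:

* `Sub₁ = HcpPeriodicMinimiser` — item stmt-AtomisticToContinuum-3061 VERBATIM (some relaxed `hcp(a,h)` with `(a,h)`
  in the box `B = {47/50 ≤ a ≤ 1, 39/50·a ≤ h ≤ 17/20·a}` is a least element of the Lennard-Jones energy per
  particle over periodic configurations) — lattice sums and stacking combinatorics, staffed on its own lines;
* `Sub₂ = HcpFarFieldOnBox` — the FAR-FIELD WALL W1, unconditional and free of item 3061: at every template of the
  box there are `ρ > 0` and a radial kernel `f` with the crux's Fourier package (conjuncts 10–14 verbatim), the forced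
  zero `𝓕F(0) = 0`, one-sided contact `f ≤ V_LJ` on `[ρ,∞)` with contact set EXACTLY `D_P ∩ [ρ,∞)`, and invisibility
  of the crystal `Σ_{y ∈ P} f(|w − y|) = 0` for all `w` — one-sided radial Fourier interpolation, refutable at a
  single template by one dual certificate, provable by one construction;
* `Sub₃ = HcpCoreCompletion` — the CORE WALL W2 as a completion statement: at a minimising template, every kernel
  carrying the tail data of a far field (range, Fourier package, strict one-sided contact) can be completed, after
  modification inside a larger ball (`f' = f` on `[ρ',∞)`), to a strict design `(ρ', f', Uc)` in the periodic normal
  form of the registered line (`stub_strictDesign`'s conclusion verbatim) — finite-range crystallisation in `ℝ³`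
  for a designed pair potential.

Proved here: `strictCertificate_of_subs : Sub₁ → Sub₂ → Sub₃ → StrictCertificate` (the glue, via the landed
`strictCertificate_of_design`), the variant `strictCertificate_of_subs_min` in which the far field is asked only at
MINIMISING box templates (so box-uniformity of `Sub₂` is not load-bearing: a refutation of `Sub₂` at a non-minimising
template calls for a resplit with the weaker piece, not for closing the line), and the necessity bookkeeping
`farField_of_strictCertificate : StrictCertificate → ∃ (a,h,ρ,f), Min(a,h) ∧ FF(a,h,ρ,f)` — a witness of the crux
delivers exactly the far-field package of `Sub₂` at its own, minimising, template (`fourier_zero_eq_zero`,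
`f_eq_lennardJones_iff`, `Field.invisible_of_isSplit`, `Slackness.witness_eq`).  All `[folklore]`.
-/

noncomputable section

namespace Summit.AtomisticToContinuum.Crystallization.Theorems.BraggSlacknessRigidityStrictCertificate.Split

open Literature.MathematicalPhysics.StatisticalMechanics
open Summit.AtomisticToContinuum.Crystallization.Theorems.BraggSlacknessRigidityStrictCertificate
  (strictCertificate_of_design fourier_zero_eq_zero f_eq_lennardJones_iff)
open Summit.AtomisticToContinuum.Crystallization.Theorems.ExactCertificateNegative (IsSplit)
open Summit.AtomisticToContinuum.Crystallization.Theorems.ChargedEnergyGapNegative (eStar_le)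
open Summit.AtomisticToContinuum.Crystallization.Theorems.ThreeConeCertificateExactCertificate.Slackness
  (witness_eq)
open Summit.AtomisticToContinuum.Crystallization.Theorems.ThreeConeCertificateExactCertificate.Field
  (invisible_of_isSplit)

/-! ## The glue of the split -/

/-- **`Sub₁ → Sub₂ → Sub₃ → StrictCertificate`** — the assembly of the three-piece split (signatures verbatim: item
3061; far field on the box; core completion at minimising templates): unpack the minimising template from `Sub₁`
(the box is used only to call `Sub₂`), take a far field there from `Sub₂`, complete its tail by `Sub₃`, and conclude
by the landed `strictCertificate_of_design`. [folklore] -/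
theorem strictCertificate_of_subs :
    (∃ a h : ℝ, ∃ (ha : a ≠ 0) (hh : h ≠ 0), 47 / 50 ≤ a ∧ a ≤ 1 ∧ 39 / 50 * a ≤ h ∧ h ≤ 17 / 20 * a ∧ IsLeast (Set.range fun Q : Literature.MathematicalPhysics.StatisticalMechanics.PeriodicConfiguration 3 => Q.energyPerParticle Literature.MathematicalPhysics.StatisticalMechanics.lennardJones) ((Literature.MathematicalPhysics.StatisticalMechanics.hcpPeriodicConfiguration ha hh).energyPerParticle Literature.MathematicalPhysics.StatisticalMechanics.lennardJones)) →
    (∀ (a h : ℝ) (ha : a ≠ 0) (hh : h ≠ 0), 47 / 50 ≤ a → a ≤ 1 → 39 / 50 * a ≤ h → h ≤ 17 / 20 * a → ∃ (ρ : ℝ) (f : ℝ → ℝ), 0 < ρ ∧ Continuous (fun v : EuclideanSpace ℝ (Fin 3) => (f ‖v‖ : ℂ)) ∧ MeasureTheory.Integrable (fun v : EuclideanSpace ℝ (Fin 3) => (f ‖v‖ : ℂ)) ∧ MeasureTheory.Integrable (FourierTransform.fourier (fun v : EuclideanSpace ℝ (Fin 3) => (f ‖v‖ : ℂ))) ∧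 (∀ ξ : EuclideanSpace ℝ (Fin 3), (FourierTransform.fourier (fun v : EuclideanSpace ℝ (Fin 3) => (f ‖v‖ : ℂ)) ξ).im = 0 ∧ 0 ≤ (FourierTransform.fourier (fun v : EuclideanSpace ℝ (Fin 3) => (f ‖v‖ : ℂ)) ξ).re) ∧ (∀ ξ : EuclideanSpace ℝ (Fin 3), ξ ≠ 0 → (∀ k : EuclideanSpace ℝ (Fin 3), (∀ g ∈ (Literature.MathematicalPhysics.StatisticalMechanics.hcpPeriodicConfiguration ha hh).lattice, ∃ n : ℤ, inner ℝ k g = (n : ℝ)) → ‖ξ‖ ≠ ‖k‖) → FourierTransform.fourier (fun v : EuclideanSpace ℝ (Fin 3) => (f ‖v‖ : ℂ)) ξ ≠ 0) ∧ FourierTransform.fourier (fun v : EuclideanSpace ℝ (Fin 3) => (f ‖v‖ : ℂ)) 0 = 0 ∧ (∀ r : ℝ, ρ ≤ r → f r ≤ Literature.MathematicalPhysics.StatisticalMechanics.lennardJones r) ∧ (∀ r : ℝ, ρ ≤ r → (f r = Literature.MathematicalPhysics.StatisticalMechanics.lennardJones r ↔ ∃ p ∈ (Literature.MathematicalPhysics.StatisticalMechanics.hcpPeriodicConfiguration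 ha hh).points, ∃ q ∈ (Literature.MathematicalPhysics.StatisticalMechanics.hcpPeriodicConfiguration ha hh).points, r = dist p q)) ∧ (∀ w : EuclideanSpace ℝ (Fin 3), HasSum (fun y : (Literature.MathematicalPhysics.StatisticalMechanics.hcpPeriodicConfiguration ha hh).points => f (dist w (y : EuclideanSpace ℝ (Fin 3)))) 0)) →
    (∀ (a h : ℝ) (ha : a ≠ 0) (hh : h ≠ 0), (∀ Q : Literature.MathematicalPhysics.StatisticalMechanics.PeriodicConfiguration 3, (Literature.MathematicalPhysics.StatisticalMechanics.hcpPeriodicConfiguration ha hh).energyPerParticle Literature.MathematicalPhysics.StatisticalMechanics.lennardJones ≤ Q.energyPerParticle Literature.MathematicalPhysics.StatisticalMechanics.lennardJones) → ∀ (ρ : ℝ) (f : ℝ → ℝ), (0 < ρ ∧ Continuous (fun v : EuclideanSpace ℝ (Fin 3) => (f ‖v‖ : ℂ)) ∧ MeasureTheory.Integrable (fun v : EuclideanSpace ℝ (Fin 3) => (f ‖v‖ : ℂ)) ∧ MeasureTheory.Integrable (FourierTransform.fourier (fun v : EuclideanSpace ℝ (Fin 3) => (f ‖v‖ : ℂ)))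 ∧ (∀ ξ : EuclideanSpace ℝ (Fin 3), (FourierTransform.fourier (fun v : EuclideanSpace ℝ (Fin 3) => (f ‖v‖ : ℂ)) ξ).im = 0 ∧ 0 ≤ (FourierTransform.fourier (fun v : EuclideanSpace ℝ (Fin 3) => (f ‖v‖ : ℂ)) ξ).re) ∧ (∀ ξ : EuclideanSpace ℝ (Fin 3), ξ ≠ 0 → (∀ k : EuclideanSpace ℝ (Fin 3), (∀ g ∈ (Literature.MathematicalPhysics.StatisticalMechanics.hcpPeriodicConfiguration ha hh).lattice, ∃ n : ℤ, inner ℝ k g = (n : ℝ)) → ‖ξ‖ ≠ ‖k‖) → FourierTransform.fourier (fun v : EuclideanSpace ℝ (Fin 3) => (f ‖v‖ : ℂ)) ξ ≠ 0) ∧ (∀ r : ℝ, ρ ≤ r → f r ≤ Literature.MathematicalPhysics.StatisticalMechanics.lennardJones r) ∧ (∀ r : ℝ, ρ ≤ r → (f r = Literature.MathematicalPhysics.StatisticalMechanics.lennardJones r ↔ ∃ p ∈ (Literature.MathematicalPhysics.StatisticalMechanics.hcpPeriodicConfiguration ha hh).points, ∃ q ∈ (Literature.MathematicalPhysics.StatisticalMechanics.hcpPeriodicConfiguration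 ha hh).points, r = dist p q))) → ∃ (ρ' : ℝ) (f' Uc : ℝ → ℝ), ρ ≤ ρ' ∧ (∀ r : ℝ, ρ' ≤ r → f' r = f r) ∧ 0 < ρ' ∧ Continuous (fun v : EuclideanSpace ℝ (Fin 3) => (f' ‖v‖ : ℂ)) ∧ MeasureTheory.Integrable (fun v : EuclideanSpace ℝ (Fin 3) => (f' ‖v‖ : ℂ)) ∧ MeasureTheory.Integrable (FourierTransform.fourier (fun v : EuclideanSpace ℝ (Fin 3) => (f' ‖v‖ : ℂ))) ∧ (∀ ξ : EuclideanSpace ℝ (Fin 3), (FourierTransform.fourier (fun v : EuclideanSpace ℝ (Fin 3) => (f' ‖v‖ : ℂ)) ξ).im = 0 ∧ 0 ≤ (FourierTransform.fourier (fun v : EuclideanSpace ℝ (Fin 3) => (f' ‖v‖ : ℂ)) ξ).re) ∧ (∀ ξ : EuclideanSpace ℝ (Fin 3), ξ ≠ 0 → (∀ k : EuclideanSpace ℝ (Fin 3), (∀ g ∈ (Literature.MathematicalPhysics.StatisticalMechanics.hcpPeriodicConfiguration ha hh).lattice, ∃ n : ℤ, inner ℝ k g = (n : ℝ)) → ‖ξ‖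 ≠ ‖k‖) → FourierTransform.fourier (fun v : EuclideanSpace ℝ (Fin 3) => (f' ‖v‖ : ℂ)) ξ ≠ 0) ∧ (∀ r : ℝ, ρ' ≤ r → f' r ≤ Literature.MathematicalPhysics.StatisticalMechanics.lennardJones r) ∧ (∀ r : ℝ, ρ' ≤ r → f' r = Literature.MathematicalPhysics.StatisticalMechanics.lennardJones r → ∃ p ∈ (Literature.MathematicalPhysics.StatisticalMechanics.hcpPeriodicConfiguration ha hh).points, ∃ q ∈ (Literature.MathematicalPhysics.StatisticalMechanics.hcpPeriodicConfiguration ha hh).points, r = dist p q) ∧ ContinuousOn Uc (Set.Ioc 0 ρ') ∧ (∀ r : ℝ, 0 < r → r < ρ' → 0 ≤ Uc r) ∧ (∀ r : ℝ, 0 < r → r < ρ' → Uc r = 0 → ∃ p ∈ (Literature.MathematicalPhysics.StatisticalMechanics.hcpPeriodicConfiguration ha hh).points, ∃ q ∈ (Literature.MathematicalPhysics.StatisticalMechanics.hcpPeriodicConfiguration ha hh).points, r = dist p q) ∧ Uc ρ' = Literature.MathematicalPhysics.StatisticalMechanics.lennardJones ρ' - f' ρ' ∧ (∀ Q : Literature.MathematicalPhysics.StatisticalMechanics.PeriodicConfiguration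 3, (Literature.MathematicalPhysics.StatisticalMechanics.hcpPeriodicConfiguration ha hh).energyPerParticle Literature.MathematicalPhysics.StatisticalMechanics.lennardJones + f' 0 / 2 ≤ Q.energyPerParticle (fun r => if r < ρ' then Literature.MathematicalPhysics.StatisticalMechanics.lennardJones r - f' r - Uc r else 0))) →
    Summit.AtomisticToContinuum.Crystallization.Theses.BraggSlacknessRigidity.StrictCertificate := by
  rintro ⟨a, h, ha, hh, h1, h2, h3, h4, hleast⟩ hFF hCC
  have hmin : (∀ Q : Literature.MathematicalPhysics.StatisticalMechanics.PeriodicConfiguration 3, (Literature.MathematicalPhysics.StatisticalMechanics.hcpPeriodicConfiguration ha hh).energyPerParticle Literature.MathematicalPhysics.StatisticalMechanics.lennardJones ≤ Q.energyPerParticle Literature.MathematicalPhysics.StatisticalMechanics.lennardJones) := fun Q => hleast.2 ⟨Q, rfl⟩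
  obtain ⟨ρ, f, hρ, hFc, hFi, hFF', hre, hstrict, -, hle, hiff, -⟩ := hFF a h ha hh h1 h2 h3 h4
  obtain ⟨ρ', f', Uc, -, -, hD⟩ := hCC a h ha hh hmin ρ f ⟨hρ, hFc, hFi, hFF', hre, hstrict, hle, hiff⟩
  exact strictCertificate_of_design a h ha hh ⟨ρ', f', Uc, hD⟩

/-- **Variant: the far field is needed only at MINIMISING box templates.** [folklore] -/
theorem strictCertificate_of_subs_min :
    (∃ a h : ℝ, ∃ (ha : a ≠ 0) (hh : h ≠ 0), 47 / 50 ≤ a ∧ a ≤ 1 ∧ 39 / 50 * a ≤ h ∧ h ≤ 17 / 20 * a ∧ IsLeast (Set.range fun Q : Literature.MathematicalPhysics.StatisticalMechanics.PeriodicConfiguration 3 => Q.energyPerParticle Literature.MathematicalPhysics.StatisticalMechanics.lennardJones) ((Literature.MathematicalPhysics.StatisticalMechanics.hcpPeriodicConfiguration ha hh).energyPerParticle Literature.MathematicalPhysics.StatisticalMechanics.lennardJones)) →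
    (∀ (a h : ℝ) (ha : a ≠ 0) (hh : h ≠ 0), 47 / 50 ≤ a → a ≤ 1 → 39 / 50 * a ≤ h → h ≤ 17 / 20 * a → (∀ Q : Literature.MathematicalPhysics.StatisticalMechanics.PeriodicConfiguration 3, (Literature.MathematicalPhysics.StatisticalMechanics.hcpPeriodicConfiguration ha hh).energyPerParticle Literature.MathematicalPhysics.StatisticalMechanics.lennardJones ≤ Q.energyPerParticle Literature.MathematicalPhysics.StatisticalMechanics.lennardJones) → ∃ (ρ : ℝ) (f : ℝ → ℝ), 0 < ρ ∧ Continuous (fun v : EuclideanSpace ℝ (Fin 3) => (f ‖v‖ : ℂ)) ∧ MeasureTheory.Integrable (fun v : EuclideanSpace ℝ (Fin 3) => (f ‖v‖ : ℂ)) ∧ MeasureTheory.Integrable (FourierTransform.fourier (fun v : EuclideanSpace ℝ (Fin 3) => (f ‖v‖ : ℂ))) ∧ (∀ ξ : EuclideanSpace ℝ (Fin 3), (FourierTransform.fourier (fun v : EuclideanSpace ℝ (Fin 3) => (f ‖v‖ : ℂ)) ξ).im = 0 ∧ 0 ≤ (FourierTransform.fourier (fun v : EuclideanSpace ℝ (Fin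 3) => (f ‖v‖ : ℂ)) ξ).re) ∧ (∀ ξ : EuclideanSpace ℝ (Fin 3), ξ ≠ 0 → (∀ k : EuclideanSpace ℝ (Fin 3), (∀ g ∈ (Literature.MathematicalPhysics.StatisticalMechanics.hcpPeriodicConfiguration ha hh).lattice, ∃ n : ℤ, inner ℝ k g = (n : ℝ)) → ‖ξ‖ ≠ ‖k‖) → FourierTransform.fourier (fun v : EuclideanSpace ℝ (Fin 3) => (f ‖v‖ : ℂ)) ξ ≠ 0) ∧ FourierTransform.fourier (fun v : EuclideanSpace ℝ (Fin 3) => (f ‖v‖ : ℂ)) 0 = 0 ∧ (∀ r : ℝ, ρ ≤ r → f r ≤ Literature.MathematicalPhysics.StatisticalMechanics.lennardJones r) ∧ (∀ r : ℝ, ρ ≤ r → (f r = Literature.MathematicalPhysics.StatisticalMechanics.lennardJones r ↔ ∃ p ∈ (Literature.MathematicalPhysics.StatisticalMechanics.hcpPeriodicConfiguration ha hh).points, ∃ q ∈ (Literature.MathematicalPhysics.StatisticalMechanics.hcpPeriodicConfiguration ha hh).points, r = dist p q)) ∧ (∀ w : EuclideanSpace ℝ (Fin 3), HasSum (fun y :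 (Literature.MathematicalPhysics.StatisticalMechanics.hcpPeriodicConfiguration ha hh).points => f (dist w (y : EuclideanSpace ℝ (Fin 3)))) 0)) →
    (∀ (a h : ℝ) (ha : a ≠ 0) (hh : h ≠ 0), (∀ Q : Literature.MathematicalPhysics.StatisticalMechanics.PeriodicConfiguration 3, (Literature.MathematicalPhysics.StatisticalMechanics.hcpPeriodicConfiguration ha hh).energyPerParticle Literature.MathematicalPhysics.StatisticalMechanics.lennardJones ≤ Q.energyPerParticle Literature.MathematicalPhysics.StatisticalMechanics.lennardJones) → ∀ (ρ : ℝ) (f : ℝ → ℝ), (0 < ρ ∧ Continuous (fun v : EuclideanSpace ℝ (Fin 3) => (f ‖v‖ : ℂ)) ∧ MeasureTheory.Integrable (fun v : EuclideanSpace ℝ (Fin 3) => (f ‖v‖ : ℂ)) ∧ MeasureTheory.Integrable (FourierTransform.fourier (fun v : EuclideanSpace ℝ (Fin 3) => (f ‖v‖ : ℂ))) ∧ (∀ ξ : EuclideanSpace ℝ (Fin 3), (FourierTransform.fourier (fun v : EuclideanSpace ℝ (Fin 3) => (f ‖v‖ : ℂ)) ξ).im = 0 ∧ 0 ≤ (FourierTransform.fourier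 (fun v : EuclideanSpace ℝ (Fin 3) => (f ‖v‖ : ℂ)) ξ).re) ∧ (∀ ξ : EuclideanSpace ℝ (Fin 3), ξ ≠ 0 → (∀ k : EuclideanSpace ℝ (Fin 3), (∀ g ∈ (Literature.MathematicalPhysics.StatisticalMechanics.hcpPeriodicConfiguration ha hh).lattice, ∃ n : ℤ, inner ℝ k g = (n : ℝ)) → ‖ξ‖ ≠ ‖k‖) → FourierTransform.fourier (fun v : EuclideanSpace ℝ (Fin 3) => (f ‖v‖ : ℂ)) ξ ≠ 0) ∧ (∀ r : ℝ, ρ ≤ r → f r ≤ Literature.MathematicalPhysics.StatisticalMechanics.lennardJones r) ∧ (∀ r : ℝ, ρ ≤ r → (f r = Literature.MathematicalPhysics.StatisticalMechanics.lennardJones r ↔ ∃ p ∈ (Literature.MathematicalPhysics.StatisticalMechanics.hcpPeriodicConfiguration ha hh).points, ∃ q ∈ (Literature.MathematicalPhysics.StatisticalMechanics.hcpPeriodicConfiguration ha hh).points, r = dist p q))) → ∃ (ρ' : ℝ) (f' Uc : ℝ → ℝ), ρ ≤ ρ' ∧ (∀ r : ℝ, ρ' ≤ r → f' r = f r) ∧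 0 < ρ' ∧ Continuous (fun v : EuclideanSpace ℝ (Fin 3) => (f' ‖v‖ : ℂ)) ∧ MeasureTheory.Integrable (fun v : EuclideanSpace ℝ (Fin 3) => (f' ‖v‖ : ℂ)) ∧ MeasureTheory.Integrable (FourierTransform.fourier (fun v : EuclideanSpace ℝ (Fin 3) => (f' ‖v‖ : ℂ))) ∧ (∀ ξ : EuclideanSpace ℝ (Fin 3), (FourierTransform.fourier (fun v : EuclideanSpace ℝ (Fin 3) => (f' ‖v‖ : ℂ)) ξ).im = 0 ∧ 0 ≤ (FourierTransform.fourier (fun v : EuclideanSpace ℝ (Fin 3) => (f' ‖v‖ : ℂ)) ξ).re) ∧ (∀ ξ : EuclideanSpace ℝ (Fin 3), ξ ≠ 0 → (∀ k : EuclideanSpace ℝ (Fin 3), (∀ g ∈ (Literature.MathematicalPhysics.StatisticalMechanics.hcpPeriodicConfiguration ha hh).lattice, ∃ n : ℤ, inner ℝ k g = (n : ℝ)) → ‖ξ‖ ≠ ‖k‖) → FourierTransform.fourier (fun v : EuclideanSpace ℝ (Fin 3) => (f' ‖v‖ : ℂ)) ξ ≠ 0) ∧ (∀ r : ℝ, ρ'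 ≤ r → f' r ≤ Literature.MathematicalPhysics.StatisticalMechanics.lennardJones r) ∧ (∀ r : ℝ, ρ' ≤ r → f' r = Literature.MathematicalPhysics.StatisticalMechanics.lennardJones r → ∃ p ∈ (Literature.MathematicalPhysics.StatisticalMechanics.hcpPeriodicConfiguration ha hh).points, ∃ q ∈ (Literature.MathematicalPhysics.StatisticalMechanics.hcpPeriodicConfiguration ha hh).points, r = dist p q) ∧ ContinuousOn Uc (Set.Ioc 0 ρ') ∧ (∀ r : ℝ, 0 < r → r < ρ' → 0 ≤ Uc r) ∧ (∀ r : ℝ, 0 < r → r < ρ' → Uc r = 0 → ∃ p ∈ (Literature.MathematicalPhysics.StatisticalMechanics.hcpPeriodicConfiguration ha hh).points, ∃ q ∈ (Literature.MathematicalPhysics.StatisticalMechanics.hcpPeriodicConfiguration ha hh).points, r = dist p q) ∧ Uc ρ' = Literature.MathematicalPhysics.StatisticalMechanics.lennardJones ρ' - f' ρ' ∧ (∀ Q : Literature.MathematicalPhysics.StatisticalMechanics.PeriodicConfiguration 3, (Literature.MathematicalPhysics.StatisticalMechanics.hcpPeriodicConfiguration ha hh).energyPerParticle Literature.MathematicalPhysics.StatisticalMechanics.lennardJones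 + f' 0 / 2 ≤ Q.energyPerParticle (fun r => if r < ρ' then Literature.MathematicalPhysics.StatisticalMechanics.lennardJones r - f' r - Uc r else 0))) →
    Summit.AtomisticToContinuum.Crystallization.Theses.BraggSlacknessRigidity.StrictCertificate := by
  rintro ⟨a, h, ha, hh, h1, h2, h3, h4, hleast⟩ hFF hCC
  have hmin : (∀ Q : Literature.MathematicalPhysics.StatisticalMechanics.PeriodicConfiguration 3, (Literature.MathematicalPhysics.StatisticalMechanics.hcpPeriodicConfiguration ha hh).energyPerParticle Literature.MathematicalPhysics.StatisticalMechanics.lennardJones ≤ Q.energyPerParticle Literature.MathematicalPhysics.StatisticalMechanics.lennardJones) := fun Q => hleast.2 ⟨Q, rfl⟩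
  obtain ⟨ρ, f, hρ, hFc, hFi, hFF', hre, hstrict, -, hle, hiff, -⟩ := hFF a h ha hh h1 h2 h3 h4 hmin
  obtain ⟨ρ', f', Uc, -, -, hD⟩ := hCC a h ha hh hmin ρ f ⟨hρ, hFc, hFi, hFF', hre, hstrict, hle, hiff⟩
  exact strictCertificate_of_design a h ha hh ⟨ρ', f', Uc, hD⟩

/-- The box-uniform far field trivially gives the minimiser-only far field. [folklore] -/
theorem farFieldMin_of_farFieldOnBox :
    (∀ (a h : ℝ) (ha : a ≠ 0) (hh : h ≠ 0), 47 / 50 ≤ a → a ≤ 1 → 39 / 50 * a ≤ h → h ≤ 17 / 20 * a → ∃ (ρ : ℝ) (f : ℝ → ℝ), 0 < ρ ∧ Continuous (fun v : EuclideanSpace ℝ (Fin 3) => (f ‖v‖ : ℂ)) ∧ MeasureTheory.Integrable (fun v : EuclideanSpace ℝ (Fin 3) => (f ‖v‖ : ℂ)) ∧ MeasureTheory.Integrable (FourierTransform.fourier (fun v : EuclideanSpace ℝ (Fin 3) => (f ‖v‖ : ℂ))) ∧ (∀ ξ : EuclideanSpace ℝ (Fin 3), (FourierTransform.fourier (fun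 v : EuclideanSpace ℝ (Fin 3) => (f ‖v‖ : ℂ)) ξ).im = 0 ∧ 0 ≤ (FourierTransform.fourier (fun v : EuclideanSpace ℝ (Fin 3) => (f ‖v‖ : ℂ)) ξ).re) ∧ (∀ ξ : EuclideanSpace ℝ (Fin 3), ξ ≠ 0 → (∀ k : EuclideanSpace ℝ (Fin 3), (∀ g ∈ (Literature.MathematicalPhysics.StatisticalMechanics.hcpPeriodicConfiguration ha hh).lattice, ∃ n : ℤ, inner ℝ k g = (n : ℝ)) → ‖ξ‖ ≠ ‖k‖) → FourierTransform.fourier (fun v : EuclideanSpace ℝ (Fin 3) => (f ‖v‖ : ℂ)) ξ ≠ 0) ∧ FourierTransform.fourier (fun v : EuclideanSpace ℝ (Fin 3) => (f ‖v‖ : ℂ)) 0 = 0 ∧ (∀ r : ℝ, ρ ≤ r → f r ≤ Literature.MathematicalPhysics.StatisticalMechanics.lennardJones r) ∧ (∀ r : ℝ, ρ ≤ r → (f r = Literature.MathematicalPhysics.StatisticalMechanics.lennardJones r ↔ ∃ p ∈ (Literature.MathematicalPhysics.StatisticalMechanics.hcpPeriodicConfiguration ha hh).points, ∃ q ∈ (Literature.MathematicalPhysics.StatisticalMechanics.hcpPeriodicConfiguration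 ha hh).points, r = dist p q)) ∧ (∀ w : EuclideanSpace ℝ (Fin 3), HasSum (fun y : (Literature.MathematicalPhysics.StatisticalMechanics.hcpPeriodicConfiguration ha hh).points => f (dist w (y : EuclideanSpace ℝ (Fin 3)))) 0)) → (∀ (a h : ℝ) (ha : a ≠ 0) (hh : h ≠ 0), 47 / 50 ≤ a → a ≤ 1 → 39 / 50 * a ≤ h → h ≤ 17 / 20 * a → (∀ Q : Literature.MathematicalPhysics.StatisticalMechanics.PeriodicConfiguration 3, (Literature.MathematicalPhysics.StatisticalMechanics.hcpPeriodicConfiguration ha hh).energyPerParticle Literature.MathematicalPhysics.StatisticalMechanics.lennardJones ≤ Q.energyPerParticle Literature.MathematicalPhysics.StatisticalMechanics.lennardJones) → ∃ (ρ : ℝ) (f : ℝ → ℝ), 0 < ρ ∧ Continuous (fun v : EuclideanSpace ℝ (Fin 3) => (f ‖v‖ : ℂ)) ∧ MeasureTheory.Integrable (fun v : EuclideanSpace ℝ (Fin 3) => (f ‖v‖ : ℂ)) ∧ MeasureTheory.Integrable (FourierTransform.fourier (fun v : EuclideanSpace ℝ (Fin 3) => (f ‖v‖ : ℂ))) ∧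 (∀ ξ : EuclideanSpace ℝ (Fin 3), (FourierTransform.fourier (fun v : EuclideanSpace ℝ (Fin 3) => (f ‖v‖ : ℂ)) ξ).im = 0 ∧ 0 ≤ (FourierTransform.fourier (fun v : EuclideanSpace ℝ (Fin 3) => (f ‖v‖ : ℂ)) ξ).re) ∧ (∀ ξ : EuclideanSpace ℝ (Fin 3), ξ ≠ 0 → (∀ k : EuclideanSpace ℝ (Fin 3), (∀ g ∈ (Literature.MathematicalPhysics.StatisticalMechanics.hcpPeriodicConfiguration ha hh).lattice, ∃ n : ℤ, inner ℝ k g = (n : ℝ)) → ‖ξ‖ ≠ ‖k‖) → FourierTransform.fourier (fun v : EuclideanSpace ℝ (Fin 3) => (f ‖v‖ : ℂ)) ξ ≠ 0) ∧ FourierTransform.fourier (fun v : EuclideanSpace ℝ (Fin 3) => (f ‖v‖ : ℂ)) 0 = 0 ∧ (∀ r : ℝ, ρ ≤ r → f r ≤ Literature.MathematicalPhysics.StatisticalMechanics.lennardJones r) ∧ (∀ r : ℝ, ρ ≤ r → (f r = Literature.MathematicalPhysics.StatisticalMechanics.lennardJones r ↔ ∃ p ∈ (Literature.MathematicalPhysics.StatisticalMechanics.hcpPeriodicConfiguration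 ha hh).points, ∃ q ∈ (Literature.MathematicalPhysics.StatisticalMechanics.hcpPeriodicConfiguration ha hh).points, r = dist p q)) ∧ (∀ w : EuclideanSpace ℝ (Fin 3), HasSum (fun y : (Literature.MathematicalPhysics.StatisticalMechanics.hcpPeriodicConfiguration ha hh).points => f (dist w (y : EuclideanSpace ℝ (Fin 3)))) 0)) :=
  fun hFF a h ha hh h1 h2 h3 h4 _ => hFF a h ha hh h1 h2 h3 h4

/-! ## Necessity bookkeeping: a witness of the crux carries the far-field package at its template -/

/-- **Registered sub-goal `farField_of_strictCertificate`: `StrictCertificate → ∃ (a,h,ρ,f), Min(a,h) ∧ FF(a,h,ρ,f)`.**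
Every witness `⟨hcp(a,h), ρ, c, g, U, f⟩` yields, at range `max ρ 1`, the far-field package of `Sub₂` at its own
template, which is a periodic minimiser: the Fourier package is verbatim, `𝓕F(0) = 0` is `fourier_zero_eq_zero`,
one-sided contact with contact set exactly `D_P` is `f_eq_lennardJones_iff` (conjunct 9), invisibility is
`Field.invisible_of_isSplit`, minimality is `Slackness.witness_eq`.  (W1 at the witness template is NECESSARY for the
crux; `Sub₂` asks it on the whole box.) [folklore] -/
theorem farField_of_strictCertificate : Summit.AtomisticToContinuum.Crystallization.Theses.BraggSlacknessRigidity.StrictCertificate → ∃ (a h : ℝ) (ha : a ≠ 0) (hh : h ≠ 0) (ρ : ℝ) (f : ℝ → ℝ), (∀ Q : Literature.MathematicalPhysics.StatisticalMechanics.PeriodicConfiguration 3, (Literature.MathematicalPhysics.StatisticalMechanics.hcpPeriodicConfiguration ha hh).energyPerParticle Literature.MathematicalPhysics.StatisticalMechanics.lennardJones ≤ Q.energyPerParticle Literature.MathematicalPhysics.StatisticalMechanics.lennardJones) ∧ (0 < ρ ∧ Continuous (fun v : EuclideanSpace ℝ (Fin 3) => (f ‖v‖ : ℂ)) ∧ MeasureTheory.Integrable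 (fun v : EuclideanSpace ℝ (Fin 3) => (f ‖v‖ : ℂ)) ∧ MeasureTheory.Integrable (FourierTransform.fourier (fun v : EuclideanSpace ℝ (Fin 3) => (f ‖v‖ : ℂ))) ∧ (∀ ξ : EuclideanSpace ℝ (Fin 3), (FourierTransform.fourier (fun v : EuclideanSpace ℝ (Fin 3) => (f ‖v‖ : ℂ)) ξ).im = 0 ∧ 0 ≤ (FourierTransform.fourier (fun v : EuclideanSpace ℝ (Fin 3) => (f ‖v‖ : ℂ)) ξ).re) ∧ (∀ ξ : EuclideanSpace ℝ (Fin 3), ξ ≠ 0 → (∀ k : EuclideanSpace ℝ (Fin 3), (∀ g ∈ (Literature.MathematicalPhysics.StatisticalMechanics.hcpPeriodicConfiguration ha hh).lattice, ∃ n : ℤ, inner ℝ k g = (n : ℝ)) → ‖ξ‖ ≠ ‖k‖) → FourierTransform.fourier (fun v : EuclideanSpace ℝ (Fin 3) => (f ‖v‖ : ℂ)) ξ ≠ 0) ∧ FourierTransform.fourier (fun v : EuclideanSpace ℝ (Fin 3) => (f ‖v‖ : ℂ)) 0 = 0 ∧ (∀ r : ℝ, ρ ≤ r → f r ≤ Literature.MathematicalPhysics.StatisticalMechanics.lennardJones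 r) ∧ (∀ r : ℝ, ρ ≤ r → (f r = Literature.MathematicalPhysics.StatisticalMechanics.lennardJones r ↔ ∃ p ∈ (Literature.MathematicalPhysics.StatisticalMechanics.hcpPeriodicConfiguration ha hh).points, ∃ q ∈ (Literature.MathematicalPhysics.StatisticalMechanics.hcpPeriodicConfiguration ha hh).points, r = dist p q)) ∧ (∀ w : EuclideanSpace ℝ (Fin 3), HasSum (fun y : (Literature.MathematicalPhysics.StatisticalMechanics.hcpPeriodicConfiguration ha hh).points => f (dist w (y : EuclideanSpace ℝ (Fin 3)))) 0)) := by
  intro hS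
  obtain ⟨P, ρ, c, g, U, f, ⟨a, h, ha, hh, rfl⟩, h1, h2, h3, h4, h5, h6, -, h9, hFc, hFi, hFF, hre,
    hstrictF⟩ := hS
  have hs : IsSplit ρ c g U f := ⟨h1, h2, h3, h4, h5⟩
  have hv : c + f 0 / 2 ≤ -((hcpPeriodicConfiguration ha hh).energyPerParticle lennardJones) := h6.le
  have hρ' : (0 : ℝ) < max ρ 1 := lt_max_of_lt_right one_pos
  refine ⟨a, h, ha, hh, max ρ 1, f, ?_, hρ', hFc, hFi, hFF, hre, hstrictF,
    fourier_zero_eq_zero hs hv hFi, ?_, ?_, fun w => invisible_of_isSplit hs hv w⟩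
  · -- template minimality, by complementary slackness
    intro Q
    rw [(witness_eq hs hv).1]
    exact eStar_le Q
  · -- one-sided contact beyond the range
    intro r hr
    have hr0 : 0 < r := lt_of_lt_of_le hρ' hr
    have hV := h1 r hr0
    rw [h3 r ((le_max_left _ _).trans hr)] at hV
    linarith [h2 r hr0]
  · -- exact contact set
    intro r hr
    exact f_eq_lennardJones_iff hs hv h9 ((le_max_left _ _).trans hr) (lt_of_lt_of_le hρ' hr)

end Summit.AtomisticToContinuum.Crystallization.Theorems.BraggSlacknessRigidityStrictCertificate.Split

end
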